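import Literature.Analysis.FluidPDE.TsaiLocalEnergyProofs
import Literature.Analysis.FluidPDE.CKNInnerCylinders
import Literature.Analysis.FluidPDE.CKNLocalEnergyEstimate
import Literature.Analysis.FluidPDE.CKNPressureEstimate
import Literature.Analysis.FluidPDE.CKNEpsilonRegularityHolds
import Literature.Analysis.FluidPDE.SereginSverakPressureProofs
import HarnessLib

/-!
# Seregin–Šverák 2002, Lemma 3.3: the `A`-criterion (small scaled kinetic energy at all small
# scales implies regularity at the vertex of a backward cylinder)

Analysis/FluidPDE proofs-layer file (theorems only; no definitions, no named facts) in the story of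
the named fact `Literature.Analysis.FluidPDE.SereginSverak2002_pressureOneSidedBound`
(`SereginSverak2002PressureLowerBound.lean`; G. Seregin, V. Šverák, *Navier–Stokes equations with
lower bounds on the pressure*, Arch. Ration. Mech. Anal. **163** (2002) 65–86,
doi:10.1007/s002050200199). The primary text is cite-only on this hub (acquisition `acq-01580`);
its **Lemma 3.3** — the ε-regularity by-product of the paper that the later literature uses
(Escauriaza–Seregin–Šverák 2003, §5; Robinson–Rodrigo–Sadowski 2016, p. 249; Phuc 2015) — is
restated *verbatim, with its number*, in the held secondary Barker–Wang 2023, §3, Lemma 1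
("stated and proven in [Seregin–Šverák 2002] (specifically Lemma 3.3)"):

> **Lemma.** There exists a positive universal constant `ε*` such that the following holds true.
> Suppose that `(v, π)` is a suitable weak solution to the Navier–Stokes equations in `Q(0, 1)`.
> Furthermore, suppose that there exists an `R* ∈ (0, 1)` such that
> `sup_{0 < R < R*} A(v, R) < ε*`. Then `(x, t) = (0, 0)` is a regular point of `v`. In particular,
> there exists an `r ∈ (0, 1)` such that `v ∈ L^∞(Q(0, r))`.

Here `Q(z₀, R) = B(x₀, R) × (t₀ - R², t₀)` are the backward cylinders (`Fluid.parabolicCylinder`),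
`A(v, z₀, R) = sup_{t₀ - R² < s < t₀} R⁻¹ ∫_{B(x₀,R)} |v(y, s)|² dy` is the scaled kinetic energy
(the tree's `cknAEss`, essential supremum in time, `≤ Fluid.cknA`), and "suitable weak solution in
`Q(0,1)`" is the Lin / Ladyzhenskaya–Seregin notion (`v ∈ L^∞_t L²_x ∩ L²_t H¹_x(Q)`,
`π ∈ L^{3/2}(Q)`, the equations in `𝒟'`, the local energy inequality): the tree's
`Fluid.IsSuitableWeakSolutionOn` on the open cylinder together with the three *global* classes on
it, exactly the hypothesis block of the accepted `tsai1998_lemma42` (Tsai 1998, Lemma 4.2, the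
backward form of Caffarelli–Kohn–Nirenberg's Proposition 2, whose smallness hypothesis is on the
dissipation `E` instead of `A`).

## What is proved

* `SereginSverak2002.aScheme` — the real-variable iteration behind the lemma: along the scales
  `θʲ r₀` the local-energy estimate (Robinson–Rodrigo–Sadowski 2016, (16.13)), the pressure
  estimate (ibid., Lemma 16.7) and the interpolation inequality (ibid., (15.31)) make
  `Yⱼ = E(θʲr₀) + θ⁻⁷ D(θʲr₀)^{4/3}` contract, `Y_{j+1} ≤ Yⱼ/2 + b`, as soon as `A ≤ ε` at all the
  scales — the rôles of `A` and `E` in Caffarelli–Kohn–Nirenberg's scheme (`CKN1982.decay_scheme`)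
  are simply exchanged, the one-step contraction being literally `CKN1982.decay_step` with `a ↔ e`;
  after `k` steps `C + D^{…}` at the last scale is below any prescribed threshold.
* `SereginSverak2002.lemma33_of_estimates` — Lemma 3.3 (for the unforced system, `ν = 1`, at every
  point `z` of a backward cylinder `Q_ρ(T, x₀)` carrying the hypotheses, up to and including its top
  `t = T`) from the tree's four decomposition targets of the ε-regularity theory:
  `localEnergyEstimate`, `pressureEstimate`, `interpolationEstimate`
  (`CKNEpsilonRegularityAssembly`)
  and `lemarieRieusset_epsilon_regularity` (Lemarié-Rieusset 2016, Thm. 14.4). The proof is that of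
  `tsai1998_lemma42_unit_of_estimates` (centres shifted into the past by `h`, uniformly in `h`; then
  `h → 0` by exhaustion of the top cylinder; then Thm. 14.4 on the top cylinder), with the
  dissipation inputs replaced by the kinetic ones: `A(s; (t - h, x)) ≤ 2 A(2s; (t, x))` for
  `h ≤ 3s²` (`cknAEss_le_mul_of_subset`).
* `SereginSverak2002.lemma33` — the same fed with the proved estimates
  (`localEnergyEstimate_holds`, `pressureEstimate_holds`, `interpolationEstimate_holds`,
  `lemarieRieusset_epsilon_regularity_holds`): an unconditional theorem.
* `SereginSverak2002.lemma33_cknA`, `SereginSverak2002.lemma33_unitCylinder` — the printed shape: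
  the supremum-in-time `A = Fluid.cknA`, strict inequality, the unit cylinder `Q(0, 1)` and the
  vertex `(0, 0)`.

* `SereginSverak2002.isBackwardBoundedAt_of_cknAEss_le` — the criterion at the final time of the
  class of the named fact: for a classical solution on `[0, T)` (`ν = 1`) which is Leray–Hopf on
  `[0, T)`, smallness `A(r; (T, x₀)) ≤ ε` for `0 < r < R` gives `IsBackwardBoundedAt u T x₀` (the
  conclusion shape of `SereginSverak2002_pressureOneSidedBound`): the gauged pair `(u, p − c)` is a
  suitable weak solution on `Q_ρ(T, x₀)`, `ρ² < T`, in the global classes (the lemmas of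
  `SereginSverakPressureProofs`), `lemma33` bounds `u` essentially on a top cylinder, and an
  essential bound of the continuous `u` is an everywhere bound.

Nothing here uses the one-sided pressure hypothesis of the main theorem of the paper; this file is
the paper's §3 input, to be combined with its §§2, 4 (not yet in the tree) in the discharge of
`SereginSverak2002_pressureOneSidedBound`: what remains to be shown there is exactly the hypothesis
of `isBackwardBoundedAt_of_cknAEss_le` at every `x₀` (after the reduction to `ν = 1`).

## References

* G. Seregin, V. Šverák, Arch. Ration. Mech. Anal. 163 (2002) 65–86, Lemma 3.3. [SereginSverak2002]
* T. Barker, W. Wang, J. Differential Equations 365 (2023) 379–407 = arXiv:2111.15444, §3 Lemma 1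
  (verbatim restatement of Lemma 3.3, read: held `paper:arxiv-2111.15444`, p. 8). [BarkerWang2023]
* T.-P. Tsai, Arch. Rational Mech. Anal. 143 (1998) 29–51, Lemma 4.2 (the parallel `E`-criterion;
  the tree's `tsai1998_lemma42_unit_of_estimates` is the template of the proof). [Tsai1998]
* J. C. Robinson, J. L. Rodrigo, W. Sadowski, CUP 2016, (15.31), (16.13)–(16.20), Lemma 16.7.
  [RobinsonRodrigoSadowski2016]
* P. G. Lemarié-Rieusset, CRC Press 2016, Thm. 14.4 (p. 505). [LemarieRieusset2016]
* L. Caffarelli, R. Kohn, L. Nirenberg, CPAM 35 (1982), Propositions 1–2, §6.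
  [CaffarelliKohnNirenberg1982]
-/

noncomputable section

open _root_.MeasureTheory Set Function Filter _root_.Topology TopologicalSpace Metric
open scoped NNReal ENNReal InnerProductSpace RealInnerProductSpace

namespace Literature.Analysis.FluidPDE


namespace SereginSverak2002

/-! ## The abstract scheme: smallness of `A` at all scales -/

/-- **The iteration behind Seregin–Šverák's Lemma 3.3, abstract real form.** Let
`κ₁, …, κ₆, C₀ ≥ 0`. There is `θ ∈ (0, 1/2]` (depending only on the `κᵢ`) such that for every
target `ε₀ > 0` there are thresholds `ε > 0` (scaled kinetic energy) and `η > 0` (force), and for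
every a-priori bound `M` a number of steps `k`, with the following property. Whenever nonnegative
sequences `a e d w : ℕ → ℝ` and a number `c ≥ 0` satisfy, for `j < k`, the local-energy estimate
`e (j+1) ≤ κ₁θ²(a j + e j) + κ₂θ⁻⁶ a j e j + κ₃θ⁻⁶ d j + κ₄θ⁻⁴ w j` and the pressure estimate
`d (j+1) ≤ κ₅θ⁻² a j e j + κ₆θ d j`, the interpolation inequality `c ≤ C₀ (a k + e k)^{3/2}` at the
last scale, the smallness `a j ≤ ε` (`j ≤ k`), `w j ≤ η` (`j < k`) and `e 0 + d 0 ≤ M`, then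
`c + (d k)^{3/4} ≤ ε₀`. This is `CKN1982.decay_scheme` with the rôles of `a` (here small) and `e`
(here merely finite at the first scale) exchanged: `Yⱼ = e j + θ⁻⁷ d j` contracts by
`CKN1982.decay_step`. (`a j`, `e j`, `d j`, `c` stand for `A(θʲr₀)`, `E(θʲr₀)`, `D(θʲr₀)^{4/3}`,
`C(θᵏr₀)`.)
[cite: SereginSverak2002, Lemma 3.3 (proof scheme; restated BarkerWang2023 §3 Lemma 1)] -/
theorem aScheme {κ₁ κ₂ κ₃ κ₄ κ₅ κ₆ C₀ : ℝ} (h₁ : 0 ≤ κ₁) (h₂ : 0 ≤ κ₂) (h₃ : 0 ≤ κ₃)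
    (h₄ : 0 ≤ κ₄) (h₅ : 0 ≤ κ₅) (h₆ : 0 ≤ κ₆) (hC₀ : 0 ≤ C₀) :
    ∃ θ : ℝ, 0 < θ ∧ θ ≤ 1 / 2 ∧ ∀ ε₀ : ℝ, 0 < ε₀ →
      ∃ ε : ℝ, 0 < ε ∧ ∃ η : ℝ, 0 < η ∧ ∀ M : ℝ, ∃ k : ℕ,
        ∀ (a e d w : ℕ → ℝ) (c : ℝ),
          (∀ j, 0 ≤ a j) → (∀ j, 0 ≤ e j) → (∀ j, 0 ≤ d j) → (∀ j, 0 ≤ w j) → 0 ≤ c →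
          (∀ j < k, e (j + 1) ≤ κ₁ * θ ^ 2 * (a j + e j) + κ₂ * (θ ^ 6)⁻¹ * (a j * e j) +
              κ₃ * (θ ^ 6)⁻¹ * d j + κ₄ * (θ ^ 4)⁻¹ * w j) →
          (∀ j < k, d (j + 1) ≤ κ₅ * (θ ^ 2)⁻¹ * (a j * e j) + κ₆ * θ * d j) →
          c ≤ C₀ * (a k + e k) ^ (3 / 2 : ℝ) →
          (∀ j ≤ k, a j ≤ ε) → (∀ j < k, w j ≤ η) → e 0 + d 0 ≤ M →
          c + d k ^ (3 / 4 : ℝ) ≤ ε₀ := by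
  -- the ratio `θ`: `(κ₁ + κ₃ + κ₆) θ ≤ 1/4`
  obtain ⟨θ, hθpos, hθhalf, hθK⟩ := CKN1982.exists_ratio_le (K := κ₁ + κ₃ + κ₆) (by positivity)
  have hθone : θ ≤ 1 := hθhalf.trans (by norm_num)
  refine ⟨θ, hθpos, hθhalf, fun ε₀ hε₀ => ?_⟩
  -- the smallness level `δ ≤ 1` for the last scale: `C₀ δ ≤ ε₀/2` and `δ ≤ (ε₀/2)²`
  obtain ⟨δ, hδpos, hδ1, hδC, hδsq⟩ : ∃ δ : ℝ, 0 < δ ∧ δ ≤ 1 ∧ C₀ * δ ≤ ε₀ / 2 ∧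
      δ ≤ (ε₀ / 2) ^ 2 := by
    obtain ⟨δ, hδpos, hδle, hδC⟩ := CKN1982.exists_threshold_le hC₀ (c := min 1 ((ε₀ / 2) ^ 2))
      (by positivity) (half_pos hε₀)
    exact ⟨δ, hδpos, hδle.trans (min_le_left _ _), hδC, hδle.trans (min_le_right _ _)⟩
  -- the kinetic threshold `ε`: `ε ≤ δ/4`, `L ε ≤ 1/4` with `L = κ₂θ⁻⁶ + κ₅θ⁻²θ⁻⁷`,
  -- and `κ₁ θ² ε ≤ δ/16`
  obtain ⟨ε, hεpos, hεδ, hεL, hεκ⟩ : ∃ ε : ℝ, 0 < ε ∧ ε ≤ δ / 4 ∧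
      (κ₂ * (θ ^ 6)⁻¹ + κ₅ * (θ ^ 2)⁻¹ * (θ ^ 7)⁻¹) * ε ≤ 1 / 4 ∧ κ₁ * θ ^ 2 * ε ≤ δ / 16 := by
    obtain ⟨ε, hεpos, hεle, hεL⟩ := CKN1982.exists_threshold_le
      (L := κ₂ * (θ ^ 6)⁻¹ + κ₅ * (θ ^ 2)⁻¹ * (θ ^ 7)⁻¹ + κ₁ * θ ^ 2) (c := δ / 4)
      (m := min (1 / 4) (δ / 16)) (by positivity) (by positivity) (by positivity)
    have hsplit : (κ₂ * (θ ^ 6)⁻¹ + κ₅ * (θ ^ 2)⁻¹ * (θ ^ 7)⁻¹ + κ₁ * θ ^ 2) * ε =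
        (κ₂ * (θ ^ 6)⁻¹ + κ₅ * (θ ^ 2)⁻¹ * (θ ^ 7)⁻¹) * ε + κ₁ * θ ^ 2 * ε := by ring
    rw [hsplit] at hεL
    have p1 : 0 ≤ (κ₂ * (θ ^ 6)⁻¹ + κ₅ * (θ ^ 2)⁻¹ * (θ ^ 7)⁻¹) * ε := by positivity
    have p2 : 0 ≤ κ₁ * θ ^ 2 * ε := by positivity
    exact ⟨ε, hεpos, hεle, by linarith [min_le_left (1 / 4 : ℝ) (δ / 16)],
      by linarith [min_le_right (1 / 4 : ℝ) (δ / 16)]⟩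
  -- the force threshold `η`: `κ₄ θ⁻⁴ η ≤ δ/16`
  obtain ⟨η, hηpos, -, hηκ⟩ := CKN1982.exists_threshold_le (L := κ₄ * (θ ^ 4)⁻¹) (c := 1)
    (m := δ / 16) (by positivity) one_pos (by positivity)
  refine ⟨ε, hεpos, η, hηpos, fun M => ?_⟩
  -- the number of steps `k`: `θ⁻⁷ max(M, 0) ≤ 2ᵏ δ/4`
  obtain ⟨k, hk⟩ : ∃ k : ℕ, (θ ^ 7)⁻¹ * max M 0 * (4 / δ) < 2 ^ k :=
    pow_unbounded_of_one_lt _ one_lt_two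
  refine ⟨k, fun a e d w c ha he hd hw hc hA hD hC hE hW hM => ?_⟩
  have hθ7 : 0 < θ ^ 7 := by positivity
  have hT : 0 < (θ ^ 7)⁻¹ := inv_pos.2 hθ7
  have hT1 : 1 ≤ (θ ^ 7)⁻¹ := one_le_inv_iff₀.2 ⟨hθ7, pow_le_one₀ hθpos.le hθone⟩
  -- the contraction `Y (j+1) ≤ Y j / 2 + b` for `Y j = e j + θ⁻⁷ d j`
  set b : ℝ := κ₁ * θ ^ 2 * ε + κ₄ * (θ ^ 4)⁻¹ * η with hb
  have hb0 : 0 ≤ b := by positivity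
  have hbδ : b ≤ δ / 8 := by linarith
  have hcoef₁ : κ₁ * θ + (κ₂ * (θ ^ 6)⁻¹ + κ₅ * (θ ^ 2)⁻¹ * (θ ^ 7)⁻¹) * ε ≤ 1 / 2 := by
    have : κ₁ * θ ≤ (κ₁ + κ₃ + κ₆) * θ := by nlinarith
    linarith
  have hcoef₂ : (κ₃ + κ₆) * θ ≤ 1 / 2 := by
    have : (κ₃ + κ₆) * θ ≤ (κ₁ + κ₃ + κ₆) * θ := by nlinarith
    linarith
  have hstep : ∀ j < k, (e (j + 1) + (θ ^ 7)⁻¹ * d (j + 1)) ≤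
      (e j + (θ ^ 7)⁻¹ * d j) / 2 + b := by
    intro j hj
    have hA' : e (j + 1) ≤ κ₁ * θ ^ 2 * (e j + a j) + κ₂ * (θ ^ 6)⁻¹ * (e j * a j) +
        κ₃ * (θ ^ 6)⁻¹ * d j + κ₄ * (θ ^ 4)⁻¹ * w j := by
      rw [add_comm (e j) (a j), mul_comm (e j) (a j)]; exact hA j hj
    have hD' : d (j + 1) ≤ κ₅ * (θ ^ 2)⁻¹ * (e j * a j) + κ₆ * θ * d j := by
      rw [mul_comm (e j) (a j)]; exact hD j hj
    exact CKN1982.decay_step (he j) (hd j) h₁ h₂ h₄ h₅ hθpos hθone hA' hD' (hE j hj.le) (hW j hj)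
      hcoef₁ hcoef₂
  have hYk : e k + (θ ^ 7)⁻¹ * d k ≤ 2 * b + (1 / 2) ^ k * (e 0 + (θ ^ 7)⁻¹ * d 0) :=
    CKN1982.seq_iterate_half_le (Y := fun j => e j + (θ ^ 7)⁻¹ * d j) hb0 hstep
  -- the a-priori bound at the first scale and the tail `2⁻ᵏ Y 0 ≤ δ/4`
  have hY0 : e 0 + (θ ^ 7)⁻¹ * d 0 ≤ (θ ^ 7)⁻¹ * max M 0 := by
    have hM' : e 0 + d 0 ≤ max M 0 := hM.trans (le_max_left _ _)
    have t1 : e 0 ≤ (θ ^ 7)⁻¹ * e 0 := le_mul_of_one_le_left (he 0) hT1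
    have t2 : (θ ^ 7)⁻¹ * (e 0 + d 0) ≤ (θ ^ 7)⁻¹ * max M 0 :=
      mul_le_mul_of_nonneg_left hM' hT.le
    rw [mul_add] at t2
    linarith
  have htail : (1 / 2) ^ k * (e 0 + (θ ^ 7)⁻¹ * d 0) ≤ δ / 4 := by
    have h2k : 0 < (2 : ℝ) ^ k := by positivity
    have hk' : (θ ^ 7)⁻¹ * max M 0 ≤ 2 ^ k * (δ / 4) := by
      have h0 : 0 ≤ (θ ^ 7)⁻¹ * max M 0 := by positivity
      have := hk.le
      rw [mul_div_assoc', div_le_iff₀ hδpos] at this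
      linarith
    have e : (1 / 2 : ℝ) ^ k = (2 ^ k)⁻¹ := by rw [one_div, inv_pow]
    rw [e, inv_mul_le_iff₀ h2k]
    exact hY0.trans hk'
  have hYkδ : e k + (θ ^ 7)⁻¹ * d k ≤ δ / 2 := by linarith
  -- the last scale
  have hdk : d k ≤ e k + (θ ^ 7)⁻¹ * d k := by
    have t1 : d k ≤ (θ ^ 7)⁻¹ * d k := le_mul_of_one_le_left (hd k) hT1
    linarith [he k]
  have hsumk : a k + e k ≤ δ := by
    have h1 := hE k le_rfl
    have h2 : 0 ≤ (θ ^ 7)⁻¹ * d k := mul_nonneg hT.le (hd k)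
    linarith
  have hsumk0 : 0 ≤ a k + e k := add_nonneg (ha k) (he k)
  have hdkδ : d k ≤ δ := by linarith
  -- `c ≤ C₀ δ^{3/2} ≤ C₀ δ ≤ ε₀/2`
  have hc' : c ≤ ε₀ / 2 := by
    have t1 : (a k + e k) ^ (3 / 2 : ℝ) ≤ δ ^ (3 / 2 : ℝ) :=
      Real.rpow_le_rpow hsumk0 hsumk (by norm_num)
    have t2 : δ ^ (3 / 2 : ℝ) ≤ δ := CKN1982.rpow_three_halves_le_self hδpos.le hδ1
    have t3 : C₀ * (a k + e k) ^ (3 / 2 : ℝ) ≤ C₀ * δ :=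
      mul_le_mul_of_nonneg_left (t1.trans t2) hC₀
    linarith
  -- `d k ^ (3/4) ≤ δ^{3/4} ≤ √δ ≤ ε₀/2`
  have hd' : d k ^ (3 / 4 : ℝ) ≤ ε₀ / 2 := by
    have t1 : d k ^ (3 / 4 : ℝ) ≤ δ ^ (3 / 4 : ℝ) := Real.rpow_le_rpow (hd k) hdkδ (by norm_num)
    have t2 : δ ^ (3 / 4 : ℝ) ≤ Real.sqrt δ := CKN1982.rpow_three_quarters_le_sqrt hδpos.le hδ1
    have t3 : Real.sqrt δ ≤ ε₀ / 2 := by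
      rw [Real.sqrt_le_left (by positivity)]
      exact hδsq
    linarith
  linarith

/-! ## Lemma 3.3 from the four analytic estimates -/

/-- **Seregin–Šverák 2002, Lemma 3.3 (the `A`-criterion), from the Caffarelli–Kohn–Nirenberg
estimates**, unforced system at unit viscosity. There is `ε > 0` such that for a suitable weak
solution `(u, p)` (zero force, `ν = 1`) on a backward cylinder `Q_ρ(T, x₀)`, in the classes
`u ∈ L^∞_t L²_x`, `∇u ∈ L²`, `p ∈ L^{3/2}` on the whole cylinder, and a point `z = (t, x)` with
`T - ρ² < t ≤ T`, `x ∈ B_ρ(x₀)`: if `A(r; z) ≤ ε` for all `0 < r < R` (some `R > 0`;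
`A = cknAEss`, backward cylinders `Q_r(z)`), then `u ∈ L^∞(Q_{r₁}(z))` for some `r₁ > 0` — the
backward cylinder reaching up to `t`, also when `t = T`. Inputs: `localEnergyEstimate`,
`pressureEstimate`, `interpolationEstimate` (run through `aScheme` at centres shifted into the past,
uniformly in the shift, the kinetic inputs being small by `A(s; (t-h, x)) ≤ 2A(2s; (t, x))`,
`h ≤ 3s²`) and `lemarieRieusset_epsilon_regularity` (on the top cylinder `Q_{r_f}(z)` after
exhausting it by truncated cylinders) — the proof of `tsai1998_lemma42_unit_of_estimates` with
`A` in place of `E`.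
[cite: SereginSverak2002, Lemma 3.3 (restated verbatim BarkerWang2023 §3 Lemma 1)] -/
theorem lemma33_of_estimates (hLE : localEnergyEstimate) (hPE : pressureEstimate)
    (hIE : interpolationEstimate) (hLR : lemarieRieusset_epsilon_regularity) :
    ∃ ε : ℝ, 0 < ε ∧
    ∀ (ρ T : ℝ) (x₀ : EuclideanSpace ℝ (Fin 3))
      (u : ℝ → EuclideanSpace ℝ (Fin 3) → EuclideanSpace ℝ (Fin 3))
      (p : ℝ → EuclideanSpace ℝ (Fin 3) → ℝ)
      (G : ℝ → EuclideanSpace ℝ (Fin 3) → EuclideanSpace ℝ (Fin 3) →L[ℝ] EuclideanSpace ℝ (Fin 3)),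
      0 < ρ →
      IsSuitableWeakSolutionOn (parabolicCylinderOpens ρ (T, x₀)) 1 0 u p →
      (∃ C : ℝ≥0, ∀ᵐ t : ℝ, t ∈ Ioo (T - ρ ^ 2) T → ∫⁻ x in ball x₀ ρ, ‖u t x‖ₑ ^ 2 ≤ C) →
      HasWeakSpatialGradientOn (parabolicCylinderOpens ρ (T, x₀)) u G →
      ∫⁻ z in parabolicCylinder ρ (T, x₀), ENNReal.ofReal (frobeniusNormSq (G z.1 z.2)) < ∞ →
      ∫⁻ z in parabolicCylinder ρ (T, x₀), ‖p z.1 z.2‖ₑ ^ (3 / 2 : ℝ) < ∞ →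
      ∀ z : ℝ × (EuclideanSpace ℝ (Fin 3)), z.1 ∈ Ioc (T - ρ ^ 2) T → z.2 ∈ ball x₀ ρ →
        ∀ R : ℝ, 0 < R → (∀ r ∈ Ioo 0 R, cknAEss r z u ≤ ENNReal.ofReal ε) →
        ∃ r₁ : ℝ, 0 < r₁ ∧
          eLpNorm (uncurry u) ∞ (volume.restrict (parabolicCylinder r₁ z)) < ∞ := by
  obtain ⟨κ₁, κ₂, κ₃, κ₄, hLE⟩ := hLE
  obtain ⟨κ₅, κ₆, hPE⟩ := hPE
  obtain ⟨C₀, hIE⟩ := hIE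
  obtain ⟨εL, CL, hεL, hCL, hLR⟩ := hLR 1 3 one_pos (by norm_num)
  -- the abstract scheme with the real constants
  obtain ⟨θ, hθ, hθhalf, hscheme⟩ := aScheme (κ₁ := (κ₁ : ℝ)) (κ₂ := (κ₂ : ℝ))
    (κ₃ := (κ₃ : ℝ)) (κ₄ := (κ₄ : ℝ))
    (κ₅ := (2 : ℝ) ^ (1 / 3 : ℝ) * (κ₅ : ℝ) ^ (4 / 3 : ℝ))
    (κ₆ := (2 : ℝ) ^ (1 / 3 : ℝ) * (κ₆ : ℝ) ^ (4 / 3 : ℝ)) (C₀ := (C₀ : ℝ))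
    κ₁.coe_nonneg κ₂.coe_nonneg κ₃.coe_nonneg κ₄.coe_nonneg (by positivity) (by positivity)
    C₀.coe_nonneg
  have hθ1 : θ ≤ 1 := hθhalf.trans (by norm_num)
  obtain ⟨ε, hε, η, hη, hsteps⟩ := hscheme (εL ^ 3) (by positivity)
  refine ⟨ε / 2, by positivity, ?_⟩
  rintro ρ T x₀ u p G hρ hsws ⟨CE, hCE⟩ hG hGint hp ⟨t, x⟩ hzt hzx R hR hAsm
  dsimp only at hzt hzx
  set Q : Opens (ℝ × (EuclideanSpace ℝ (Fin 3))) := parabolicCylinderOpens ρ (T, x₀) with hQdef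
  have hQ : (Q : Set (ℝ × (EuclideanSpace ℝ (Fin 3)))) = parabolicCylinder ρ (T, x₀) := rfl
  -- the gradient carrying the local energy inequality, and its identification with `G`
  obtain ⟨G₀, hG₀, -, hloc⟩ := hsws.localEnergy
  set F : ℝ × (EuclideanSpace ℝ (Fin 3)) → ℝ≥0∞ :=
    fun w => ENNReal.ofReal (frobeniusNormSq (G w.1 w.2)) with hF
  set F₀ : ℝ × (EuclideanSpace ℝ (Fin 3)) → ℝ≥0∞ :=
    fun w => ENNReal.ofReal (frobeniusNormSq (G₀ w.1 w.2)) with hF₀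
  have hae : ∀ᵐ w ∂(volume.restrict (Q : Set (ℝ × (EuclideanSpace ℝ (Fin 3))))), F₀ w = F w := by
    filter_upwards [hG₀.ae_eq hG] with w hw
    simp only [hF, hF₀]
    change ENNReal.ofReal (frobeniusNormSq (uncurry G₀ w)) =
      ENNReal.ofReal (frobeniusNormSq (uncurry G w))
    rw [hw]
  have hFF : ∀ S : Set (ℝ × (EuclideanSpace ℝ (Fin 3))),
      S ⊆ (Q : Set (ℝ × (EuclideanSpace ℝ (Fin 3)))) →
      ∫⁻ w in S, F₀ w = ∫⁻ w in S, F w :=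
    fun S hS => lintegral_congr_ae (ae_restrict_of_ae_restrict_of_subset hS hae)
  have hG₀int : ∫⁻ w in (Q : Set (ℝ × (EuclideanSpace ℝ (Fin 3)))), F₀ w < ∞ := by
    rw [hFF _ Subset.rfl, hQ]
    exact hGint
  -- the energy class in indicator form
  have hCEind : ∀ᵐ s : ℝ, ∫⁻ y, (Q : Set (ℝ × (EuclideanSpace ℝ (Fin 3)))).indicator
      (fun w : ℝ × (EuclideanSpace ℝ (Fin 3)) => ‖u w.1 w.2‖ₑ ^ 2) (s, y) ≤ CE := by
    rw [hQ, parabolicCylinder]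
    exact ae_lintegral_indicator_prod_le measurableSet_ball hCE
  have hp' :
      ∫⁻ w in (Q : Set (ℝ × (EuclideanSpace ℝ (Fin 3)))), ‖p w.1 w.2‖ₑ ^ (3 / 2 : ℝ) < ∞ := by
    rw [hQ]; exact hp
  -- the zero force
  have hfq : MemLp (uncurry (0 : ℝ → (EuclideanSpace ℝ (Fin 3)) → (EuclideanSpace ℝ (Fin 3))))
      (ENNReal.ofReal 3) (volume.restrict (Q : Set (ℝ × (EuclideanSpace ℝ (Fin 3))))) :=
    (MemLp.zero :
      MemLp (0 : ℝ × (EuclideanSpace ℝ (Fin 3)) → (EuclideanSpace ℝ (Fin 3))) (ENNReal.ofReal 3)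
      (volume.restrict (Q : Set (ℝ × (EuclideanSpace ℝ (Fin 3))))))
  have hfli :
      LocallyIntegrableOn
        (uncurry (0 : ℝ → (EuclideanSpace ℝ (Fin 3)) → (EuclideanSpace ℝ (Fin 3))))
        (Q : Set (ℝ × (EuclideanSpace ℝ (Fin 3)))) volume :=
    locallyIntegrableOn_of_memLp (by norm_num) hfq
  have hdiv : ∀ φ : ℝ → (EuclideanSpace ℝ (Fin 3)) → ℝ, IsSpaceTimeTestOn Q φ →
      ∫ s, ∫ y,
        ⟪(0 : ℝ → (EuclideanSpace ℝ (Fin 3)) → (EuclideanSpace ℝ (Fin 3))) s y,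
          gradient (φ s) y⟫ = 0 :=
    fun φ _ => by simp
  have hF0 : ∀ (r : ℝ) (w : ℝ × (EuclideanSpace ℝ (Fin 3))),
      cknF 3 r w (0 : ℝ → (EuclideanSpace ℝ (Fin 3)) → (EuclideanSpace ℝ (Fin 3))) = 0 :=
    fun r w => cknF_zero_force (by norm_num) r w
  -- ## geometry: the margins of the point `(t, x)` inside `Q`
  have hgt : 0 < t - (T - ρ ^ 2) := sub_pos.2 hzt.1
  have hgx : 0 < ρ - dist x x₀ := sub_pos.2 (mem_ball.1 hzx)
  obtain ⟨r₁, hr₁, hr₁t, hr₁x⟩ : ∃ r₁ : ℝ, 0 < r₁ ∧ 4 * r₁ ^ 2 < t - (T - ρ ^ 2) ∧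
      2 * r₁ < ρ - dist x x₀ := by
    set g : ℝ := min (t - (T - ρ ^ 2)) (ρ - dist x x₀) with hg
    have hg0 : 0 < g := lt_min hgt hgx
    refine ⟨min (g / 4) (1 / 2), by positivity, ?_, ?_⟩
    · have h1 : 2 * min (g / 4) (1 / 2) ≤ g / 2 := by linarith [min_le_left (g / 4) (1 / 2)]
      have h2 : 2 * min (g / 4) (1 / 2) ≤ 1 := by linarith [min_le_right (g / 4) (1 / 2)]
      have h3 : 0 ≤ 2 * min (g / 4) (1 / 2) := by positivity
      calc 4 * min (g / 4) (1 / 2) ^ 2 = (2 * min (g / 4) (1 / 2)) * (2 * min (g / 4) (1 / 2)) := by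
            ring
        _ ≤ g / 2 * 1 := mul_le_mul h1 h2 h3 (by positivity)
        _ < g := by linarith
        _ ≤ t - (T - ρ ^ 2) := min_le_left _ _
    · calc 2 * min (g / 4) (1 / 2) ≤ 2 * (g / 4) := by gcongr; exact min_le_left _ _
        _ < g := by linarith
        _ ≤ ρ - dist x x₀ := min_le_right _ _
  -- shifted cylinders `Q_r(t - h, x)`, `0 < h ≤ r₁²`, `0 < r ≤ r₁`, have closure inside `Q`
  have hclQ : ∀ h r, 0 < h → h ≤ r₁ ^ 2 → 0 < r → r ≤ r₁ →
      closure (parabolicCylinder r (t - h, x)) ⊆ (Q : Set (ℝ × (EuclideanSpace ℝ (Fin 3)))) := by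
    intro h r hh0 hh hr hrr
    refine (closure_parabolicCylinder_subset r _).trans ?_
    rw [hQ, parabolicCylinder]
    refine prod_mono ?_ ?_
    · intro s hs
      simp only [mem_Icc] at hs
      simp only [mem_Ioo]
      have : r ^ 2 ≤ r₁ ^ 2 := pow_le_pow_left₀ hr.le hrr 2
      constructor <;> nlinarith [hzt.2]
    · exact closedBall_subset_ball' (by simp only; linarith [hrr])
  -- a shifted cylinder lies in the doubled one: `Q_r(t - h, x) ⊆ Q_{2r}(t, x)` for `0 ≤ h ≤ 3r²`,
  -- through the inclusions of the time windows and of the base balls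
  have hshiftI : ∀ h r, 0 ≤ h → 0 < r → h ≤ 3 * r ^ 2 →
      Ioo ((t - h, x).1 - r ^ 2) (t - h, x).1 ⊆ Ioo ((t, x).1 - (2 * r) ^ 2) (t, x).1 := by
    intro h r hh0 hr hh
    simp only
    exact Ioo_subset_Ioo (by nlinarith) (by linarith)
  have hshiftB : ∀ r, 0 < r → ball (t, x).2 r ⊆ ball (t, x).2 (2 * r) :=
    fun r hr => ball_subset_ball (by linarith)
  -- the starting scale `r₀`: `r₀ ≤ r₁` and `2 r₀ < R`
  obtain ⟨r₀, hr₀, hr₀r₁, hr₀R⟩ : ∃ r₀ : ℝ, 0 < r₀ ∧ r₀ ≤ r₁ ∧ 2 * r₀ < R :=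
    ⟨min r₁ (R / 4), by positivity, min_le_left _ _,
      by linarith [min_le_right r₁ (R / 4)]⟩
  -- the a-priori bound `M` and the number of steps `k`
  set Np : ℝ≥0∞ := ∫⁻ w in (Q : Set (ℝ × (EuclideanSpace ℝ (Fin 3)))), ‖p w.1 w.2‖ₑ ^ (3 / 2 : ℝ)
    with hNp
  set NG : ℝ≥0∞ := ∫⁻ w in (Q : Set (ℝ × (EuclideanSpace ℝ (Fin 3)))), F₀ w with hNG
  obtain ⟨k, hk⟩ := hsteps
    (((ENNReal.ofReal r₀)⁻¹ * NG).toReal +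
      ((((ENNReal.ofReal r₀) ^ 2)⁻¹ * Np) ^ (4 / 3 : ℝ)).toReal)
  -- the last scale `rf`
  obtain ⟨rf, hrfdef⟩ : ∃ rf : ℝ, rf = θ ^ k * r₀ := ⟨_, rfl⟩
  have hrf : 0 < rf := by rw [hrfdef]; positivity
  have hrfr₀ : rf ≤ r₀ := by
    rw [hrfdef]; exact mul_le_of_le_one_left hr₀.le (pow_le_one₀ hθ.le hθ1)
  have hrfr₁ : rf ≤ r₁ := hrfr₀.trans hr₀r₁
  -- the scales `s j = θʲ r₀`
  have hs0 : ∀ j : ℕ, 0 < θ ^ j * r₀ := fun j => by positivity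
  have hsr₀ : ∀ j : ℕ, θ ^ j * r₀ ≤ r₀ := fun j =>
    mul_le_of_le_one_left hr₀.le (pow_le_one₀ hθ.le hθ1)
  have hsrf : ∀ j ≤ k, rf ≤ θ ^ j * r₀ := fun j hj => by
    rw [hrfdef]
    exact mul_le_mul_of_nonneg_right (pow_le_pow_of_le_one hθ.le hθ1 hj) hr₀.le
  have hsucc : ∀ j : ℕ, θ * (θ ^ j * r₀) = θ ^ (j + 1) * r₀ := fun j => by rw [pow_succ]; ring
  -- ## the decay scheme at the shifted centres `(t - h, x)`, `0 < h ≤ min r₁² (3 rf²)`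
  have hstep : ∀ h : ℝ, 0 < h → h ≤ r₁ ^ 2 → h ≤ 3 * rf ^ 2 →
      cknC rf (t - h, x) u + cknD rf (t - h, x) p ≤ ENNReal.ofReal (εL ^ 3) := by
    intro h hh0 hhr₁ hhrf
    set z' : ℝ × (EuclideanSpace ℝ (Fin 3)) := (t - h, x) with hz'
    have hclQ' : ∀ r, 0 < r → r ≤ r₀ →
        closure (parabolicCylinder r z') ⊆ (Q : Set (ℝ × (EuclideanSpace ℝ (Fin 3)))) :=
      fun r hr hrr => hclQ h r hh0 hhr₁ hr (hrr.trans hr₀r₁)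
    have hsubQ : ∀ r, 0 < r → r ≤ r₀ →
        parabolicCylinder r z' ⊆ (Q : Set (ℝ × (EuclideanSpace ℝ (Fin 3)))) :=
      fun r hr hrr => subset_closure.trans (hclQ' r hr hrr)
    -- finiteness of the scaled quantities at admissible radii
    have hAle : ∀ r, 0 < r → r ≤ r₀ → cknAEss r z' u ≤ (ENNReal.ofReal r)⁻¹ * CE :=
      fun r hr hrr => cknAEss_le_of_energy hCEind (hsubQ r hr hrr)
    have hAfin : ∀ r, 0 < r → r ≤ r₀ → cknAEss r z' u ≠ ∞ := fun r hr hrr =>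
      ne_top_of_le_ne_top (ENNReal.mul_ne_top (ENNReal.inv_ne_top.2 (ENNReal.ofReal_pos.2 hr).ne')
        ENNReal.coe_ne_top) (hAle r hr hrr)
    have hEle : ∀ r, 0 < r → r ≤ r₀ → cknE r z' G₀ ≤ (ENNReal.ofReal r)⁻¹ * NG :=
      fun r hr hrr => cknE_le_of_subset G₀ (hsubQ r hr hrr)
    have hEfin : ∀ r, 0 < r → r ≤ r₀ → cknE r z' G₀ ≠ ∞ := fun r hr hrr =>
      ne_top_of_le_ne_top (ENNReal.mul_ne_top (ENNReal.inv_ne_top.2 (ENNReal.ofReal_pos.2 hr).ne')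
        hG₀int.ne) (hEle r hr hrr)
    have hDfin : ∀ r, 0 < r → r ≤ r₀ → cknD r z' p ≠ ∞ := fun r hr hrr =>
      ne_top_of_le_ne_top (ENNReal.mul_ne_top
        (ENNReal.inv_ne_top.2 (pow_ne_zero 2 (ENNReal.ofReal_pos.2 hr).ne')) hp'.ne)
        (cknD_le_of_subset p (hsubQ r hr hrr))
    have hFfin :
        ∀ r, cknF 3 r z' (0 : ℝ → (EuclideanSpace ℝ (Fin 3)) → (EuclideanSpace ℝ (Fin 3))) ≠ ∞ :=
        fun r => by
      rw [hF0]; exact ENNReal.zero_ne_top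
    have hGr : ∀ r, 0 < r → r ≤ r₀ →
        HasWeakSpatialGradientOn (parabolicCylinderOpens r z') u G₀ :=
      fun r hr hrr => hG₀.mono (hsubQ r hr hrr)
    have hCfin : ∀ r, 0 < r → r ≤ r₀ → cknC r z' u ≠ ∞ := fun r hr hrr =>
      ne_top_of_le_ne_top (ENNReal.mul_ne_top ENNReal.coe_ne_top (ENNReal.rpow_ne_top_of_nonneg
        (by norm_num) (ENNReal.add_ne_top.2 ⟨hAfin r hr hrr, hEfin r hr hrr⟩)))
        (hIE u G₀ z' r hr (hGr r hr hrr) (hAfin r hr hrr) (hEfin r hr hrr))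
    -- the kinetic inputs are small: `A(s; z') ≤ 2 A(2s; (t, x)) ≤ ε` for `rf ≤ s ≤ r₀`
    have hAsmall : ∀ j ≤ k, (cknAEss (θ ^ j * r₀) z' u).toReal ≤ ε := by
      intro j hj
      have hs := hs0 j
      have hle3 : h ≤ 3 * (θ ^ j * r₀) ^ 2 :=
        hhrf.trans (by nlinarith [hsrf j hj, hrf])
      have h1 : cknAEss (θ ^ j * r₀) z' u ≤
          ENNReal.ofReal (2 * (θ ^ j * r₀) / (θ ^ j * r₀)) * cknAEss (2 * (θ ^ j * r₀)) (t, x) u :=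
        cknAEss_le_mul_of_subset (by positivity) hs (hshiftI h _ hh0.le hs hle3) (hshiftB _ hs) u
      have e2 : ENNReal.ofReal (2 * (θ ^ j * r₀) / (θ ^ j * r₀)) = 2 := by
        rw [mul_div_assoc, div_self hs.ne', mul_one, ENNReal.ofReal_ofNat]
      rw [e2] at h1
      have h2 : cknAEss (2 * (θ ^ j * r₀)) (t, x) u ≤ ENNReal.ofReal (ε / 2) :=
        hAsm _ ⟨by positivity, by nlinarith [hsr₀ j]⟩
      refine ENNReal.toReal_le_of_le_ofReal hε.le (h1.trans ?_)
      calc 2 * cknAEss (2 * (θ ^ j * r₀)) (t, x) u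
          ≤ 2 * ENNReal.ofReal (ε / 2) := mul_le_mul_right h2 _
        _ = ENNReal.ofReal ε := by rw [← ofReal_two_mul]; congr 1; ring
    -- the real sequences and the scheme
    have hmain := hk (fun j => (cknAEss (θ ^ j * r₀) z' u).toReal)
      (fun j => (cknE (θ ^ j * r₀) z' G₀).toReal)
      (fun j => (cknD (θ ^ j * r₀) z' p ^ (4 / 3 : ℝ)).toReal)
      (fun j =>
        (cknF 3 (θ ^ j * r₀) z'
          (0 : ℝ → (EuclideanSpace ℝ (Fin 3)) → (EuclideanSpace ℝ (Fin 3))) ^ (2 / (3 : ℝ))).toReal)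
      ((cknC (θ ^ k * r₀) z' u).toReal)
      (fun j => ENNReal.toReal_nonneg) (fun j => ENNReal.toReal_nonneg)
      (fun j => ENNReal.toReal_nonneg) (fun j => ENNReal.toReal_nonneg) ENNReal.toReal_nonneg
      (fun j hj => by
        -- local-energy estimate at `(s j, θ)` (the left-hand side `E(θ s) ≤ A(θ s) + E(θ s)`)
        have H := hLE Q 3 0 u p G₀ hsws (by norm_num) hfq hG₀ z' (θ ^ j * r₀) θ (hs0 j) hθ hθhalf
          (hclQ' _ (hs0 j) (hsr₀ j))
        rw [hsucc j] at H
        exact real_localEnergy le_add_self H (by norm_num) (hAfin _ (hs0 j) (hsr₀ j))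
          (hEfin _ (hs0 j) (hsr₀ j)) (hDfin _ (hs0 j) (hsr₀ j)) (hFfin _))
      (fun j hj => by
        -- pressure estimate at `(s j, θ)`
        have H := hPE Q 0 u p G₀ hsws hfli hdiv hG₀ z' (θ ^ j * r₀) θ (hs0 j) hθ hθhalf
          (hclQ' _ (hs0 j) (hsr₀ j))
        rw [hsucc j] at H
        exact real_pressure hθ hθ1 H (hAfin _ (hs0 j) (hsr₀ j)) (hEfin _ (hs0 j) (hsr₀ j))
          (hDfin _ (hs0 j) (hsr₀ j)))
      (by
        -- interpolation at the last scale
        exact real_interpolation (hIE u G₀ z' (θ ^ k * r₀) (hs0 k) (hGr _ (hs0 k) (hsr₀ k))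
          (hAfin _ (hs0 k) (hsr₀ k)) (hEfin _ (hs0 k) (hsr₀ k))) (hAfin _ (hs0 k) (hsr₀ k))
          (hEfin _ (hs0 k) (hsr₀ k)))
      hAsmall
      (fun j hj => by
        -- force smallness (the force vanishes)
        refine real_force (q := 3) (by norm_num) hη.le ?_
        rw [hF0]
        exact zero_le)
      (by
        -- the a-priori bound at `r₀`, uniform in the shift `h`
        have e0 : θ ^ 0 * r₀ = r₀ := by simp
        simp only [e0]
        have hE0 : cknE r₀ z' G₀ ≤ (ENNReal.ofReal r₀)⁻¹ * NG := hEle r₀ hr₀ le_rfl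
        have hD0 : cknD r₀ z' p ^ (4 / 3 : ℝ) ≤ (((ENNReal.ofReal r₀) ^ 2)⁻¹ * Np) ^ (4 / 3 : ℝ) :=
          ENNReal.rpow_le_rpow (cknD_le_of_subset p (hsubQ r₀ hr₀ le_rfl)) (by norm_num)
        have hfinE : (ENNReal.ofReal r₀)⁻¹ * NG ≠ ∞ :=
          ENNReal.mul_ne_top (ENNReal.inv_ne_top.2 (ENNReal.ofReal_pos.2 hr₀).ne') hG₀int.ne
        have hfinD : (((ENNReal.ofReal r₀) ^ 2)⁻¹ * Np) ^ (4 / 3 : ℝ) ≠ ∞ :=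
          ENNReal.rpow_ne_top_of_nonneg (by norm_num) (ENNReal.mul_ne_top
            (ENNReal.inv_ne_top.2 (pow_ne_zero 2 (ENNReal.ofReal_pos.2 hr₀).ne')) hp'.ne)
        exact add_le_add (ENNReal.toReal_mono hfinE hE0) (ENNReal.toReal_mono hfinD hD0))
    -- back to `ℝ≥0∞`
    beta_reduce at hmain
    rw [← hrfdef] at hmain
    exact add_le_ofReal_of_real (hCfin rf hrf hrfr₀) (hDfin rf hrf hrfr₀) hmain
  -- ## smallness at the point `(t, x)` itself: exhaust `Q_rf(t, x)` by the truncated cylinders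
  -- `(t - rf², t - hₙ) × B(x, rf) ⊆ Q_rf(t - hₙ, x)`, `hₙ ↓ 0`
  set c₁ : ℝ := min (r₁ ^ 2) (3 * rf ^ 2) with hc₁
  have hc₁0 : 0 < c₁ := lt_min (by positivity) (by positivity)
  set hs : ℕ → ℝ := fun n => c₁ / ((n : ℝ) + 1) with hhs
  have hhs0 : ∀ n, 0 < hs n := fun n => by positivity
  have hhsc : ∀ n, hs n ≤ c₁ := fun n => by
    rw [hhs]
    exact div_le_self hc₁0.le (by linarith [n.cast_nonneg (α := ℝ)])
  set A : ℕ → Set (ℝ × (EuclideanSpace ℝ (Fin 3))) :=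
    fun n => Ioo (t - rf ^ 2) (t - hs n) ×ˢ ball x rf with hA
  have hAmono : Monotone A := by
    intro m n hmn
    refine prod_mono (Ioo_subset_Ioo le_rfl ?_) Subset.rfl
    have : hs n ≤ hs m := by
      rw [hhs]
      exact div_le_div_of_nonneg_left hc₁0.le (by positivity)
        (by exact_mod_cast Nat.succ_le_succ hmn)
    linarith
  have hAsub : ∀ n, A n ⊆ parabolicCylinder rf (t - hs n, x) := by
    intro n
    rw [parabolicCylinder]
    refine prod_mono (Ioo_subset_Ioo ?_ le_rfl) Subset.rfl
    simp only
    linarith [hhs0 n]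
  have hAU : (⋃ n, A n) = parabolicCylinder rf (t, x) := by
    ext w
    simp only [mem_iUnion, hA, parabolicCylinder, mem_prod, mem_Ioo]
    constructor
    · rintro ⟨n, ⟨h1, h2⟩, h3⟩
      exact ⟨⟨h1, by linarith [hhs0 n]⟩, h3⟩
    · rintro ⟨⟨h1, h2⟩, h3⟩
      obtain ⟨n, hn⟩ := exists_nat_gt (c₁ / (t - w.1))
      refine ⟨n, ⟨h1, ?_⟩, h3⟩
      have hgap : 0 < t - w.1 := sub_pos.2 h2
      have : hs n < t - w.1 := by
        rw [hhs, div_lt_iff₀ (by positivity)]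
        have := (div_lt_iff₀ hgap).1 hn
        nlinarith
      linarith
  have hsmallz : cknC rf (t, x) u + cknD rf (t, x) p ≤ ENNReal.ofReal (εL ^ 3) := by
    have hdir : Directed (· ⊆ ·) A := hAmono.directed_le
    have eC : cknC rf (t, x) u = ⨆ n, (ENNReal.ofReal rf ^ 2)⁻¹ *
        (∫⁻ w in A n, ‖u w.1 w.2‖ₑ ^ (3 : ℕ)) := by
      rw [cknC, ← hAU, setLIntegral_iUnion_of_directed _ hdir, ENNReal.mul_iSup]
    have eD : cknD rf (t, x) p = ⨆ n, (ENNReal.ofReal rf ^ 2)⁻¹ *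
        (∫⁻ w in A n, ‖p w.1 w.2‖ₑ ^ (3 / 2 : ℝ)) := by
      rw [cknD, ← hAU, setLIntegral_iUnion_of_directed _ hdir, ENNReal.mul_iSup]
    rw [eC, eD]
    refine ENNReal.iSup_add_iSup_le fun i j => ?_
    have hi : A i ⊆ parabolicCylinder rf (t - hs (max i j), x) :=
      (hAmono (le_max_left i j)).trans (hAsub _)
    have hj : A j ⊆ parabolicCylinder rf (t - hs (max i j), x) :=
      (hAmono (le_max_right i j)).trans (hAsub _)
    calc (ENNReal.ofReal rf ^ 2)⁻¹ * (∫⁻ w in A i, ‖u w.1 w.2‖ₑ ^ (3 : ℕ)) +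
          (ENNReal.ofReal rf ^ 2)⁻¹ * (∫⁻ w in A j, ‖p w.1 w.2‖ₑ ^ (3 / 2 : ℝ))
        ≤ cknC rf (t - hs (max i j), x) u + cknD rf (t - hs (max i j), x) p :=
          add_le_add (mul_le_mul_right (lintegral_mono_set hi) _)
            (mul_le_mul_right (lintegral_mono_set hj) _)
      _ ≤ ENNReal.ofReal (εL ^ 3) := hstep (hs (max i j)) (hhs0 _)
          ((hhsc _).trans (min_le_left _ _)) ((hhsc _).trans (min_le_right _ _))
  -- ## the one-scale criterion on the top cylinder `Q_rf(t, x)`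
  have hsubz : parabolicCylinder rf (t, x) ⊆ (Q : Set (ℝ × (EuclideanSpace ℝ (Fin 3)))) := by
    rw [hQ, parabolicCylinder, parabolicCylinder]
    refine prod_mono ?_ (ball_subset_ball' (by simp only; linarith))
    simp only
    have : rf ^ 2 ≤ r₁ ^ 2 := pow_le_pow_left₀ hrf.le hrfr₁ 2
    exact Ioo_subset_Ioo (by nlinarith) hzt.2
  have hmeas_u : AEMeasurable (fun w : ℝ × (EuclideanSpace ℝ (Fin 3)) => ‖u w.1 w.2‖ₑ ^ (3 : ℕ))
      (volume.restrict (parabolicCylinder rf (t, x))) := by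
    have h1 : AEStronglyMeasurable (uncurry u) (volume.restrict (parabolicCylinder rf (t, x))) :=
      hsws.distributional.1.aestronglyMeasurable.mono_measure (Measure.restrict_mono hsubz le_rfl)
    exact (h1.aemeasurable.enorm.pow_const 3)
  have hint : ∫⁻ w in parabolicCylinder rf (t, x),
      (‖u w.1 w.2‖ₑ ^ (3 : ℕ) + ‖p w.1 w.2‖ₑ ^ (3 / 2 : ℝ)) ≤ ENNReal.ofReal (εL ^ 3 * rf ^ 2) := by
    rw [lintegral_add_left' hmeas_u]
    have hc0 : (ENNReal.ofReal rf ^ 2) ≠ 0 := pow_ne_zero 2 (ENNReal.ofReal_pos.2 hrf).ne'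
    have hctop : (ENNReal.ofReal rf ^ 2) ≠ ∞ := ENNReal.pow_ne_top ENNReal.ofReal_ne_top
    have h1 : (ENNReal.ofReal rf ^ 2)⁻¹ *
        ((∫⁻ w in parabolicCylinder rf (t, x), ‖u w.1 w.2‖ₑ ^ (3 : ℕ)) +
          (∫⁻ w in parabolicCylinder rf (t, x), ‖p w.1 w.2‖ₑ ^ (3 / 2 : ℝ))) ≤
        ENNReal.ofReal (εL ^ 3) := by
      rw [mul_add]
      exact hsmallz
    have h2 := mul_le_mul_right h1 (ENNReal.ofReal rf ^ 2)
    rw [← mul_assoc, ENNReal.mul_inv_cancel hc0 hctop, one_mul] at h2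
    refine h2.trans (le_of_eq ?_)
    rw [← ENNReal.ofReal_pow hrf.le, ← ENNReal.ofReal_mul (by positivity), mul_comm]
  have hforce : ∫⁻ w in parabolicCylinder rf (t, x),
      ‖(0 : ℝ → (EuclideanSpace ℝ (Fin 3)) → (EuclideanSpace ℝ (Fin 3))) w.1 w.2‖ₑ ^ (3 : ℝ) ≤
      ENNReal.ofReal (εL ^ ((2 : ℝ) * 3) * rf ^ ((5 : ℝ) - 3 * 3)) := by
    simp [ENNReal.zero_rpow_of_pos (by norm_num : (0 : ℝ) < 3)]
  have hbdd := hLR Q 0 u p G₀ (by rw [hQ]; exact isConnected_parabolicCylinder hρ _)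
    ⟨CE, hCEind⟩ hG₀ hG₀int hp' hfq hsws.distributional hloc (t, x) rf εL hrf hsubz hεL.le le_rfl
    hint hforce
  refine ⟨rf / 2, by positivity, ?_⟩
  rw [eLpNorm_exponent_top]
  exact eLpNormEssSup_lt_top_of_ae_bound (C := CL * εL / rf) hbdd

/-! ## Lemma 3.3, unconditionally -/

/-- **Seregin–Šverák 2002, Lemma 3.3 (the `A`-criterion)**, unforced system, unit viscosity,
essential-supremum form of `A`. There is a universal `ε > 0` such that: if `(u, p)` is a suitable
weak solution on a backward cylinder `Q_ρ(T, x₀)` (`u ∈ L^∞_t L²_x`, `∇u ∈ L²`, `p ∈ L^{3/2}` on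
the cylinder, the equations in `𝒟'`, the local energy inequality), `z = (t, x)` is a point with
`T - ρ² < t ≤ T`, `x ∈ B_ρ(x₀)`, and `A(r; z) = ess sup_{t-r²<s<t} r⁻¹ ∫_{B_r(x)} |u(s)|² ≤ ε` for
all `0 < r < R` (some `R > 0`), then `u` is essentially bounded on some backward cylinder
`Q_{r₁}(z)`, `r₁ > 0` — `z` is a regular point in the backward sense, also at the top `t = T`.
Proved: `lemma33_of_estimates` fed with the tree's discharged Caffarelli–Kohn–Nirenberg
estimates and Lemarié-Rieusset's Thm. 14.4.
[cite: SereginSverak2002, Lemma 3.3 (restated verbatim BarkerWang2023 §3 Lemma 1)] -/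
theorem lemma33 :
    ∃ ε : ℝ, 0 < ε ∧
    ∀ (ρ T : ℝ) (x₀ : EuclideanSpace ℝ (Fin 3))
      (u : ℝ → EuclideanSpace ℝ (Fin 3) → EuclideanSpace ℝ (Fin 3))
      (p : ℝ → EuclideanSpace ℝ (Fin 3) → ℝ)
      (G : ℝ → EuclideanSpace ℝ (Fin 3) → EuclideanSpace ℝ (Fin 3) →L[ℝ] EuclideanSpace ℝ (Fin 3)),
      0 < ρ →
      IsSuitableWeakSolutionOn (parabolicCylinderOpens ρ (T, x₀)) 1 0 u p →
      (∃ C : ℝ≥0, ∀ᵐ t : ℝ, t ∈ Ioo (T - ρ ^ 2) T → ∫⁻ x in ball x₀ ρ, ‖u t x‖ₑ ^ 2 ≤ C) →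
      HasWeakSpatialGradientOn (parabolicCylinderOpens ρ (T, x₀)) u G →
      ∫⁻ z in parabolicCylinder ρ (T, x₀), ENNReal.ofReal (frobeniusNormSq (G z.1 z.2)) < ∞ →
      ∫⁻ z in parabolicCylinder ρ (T, x₀), ‖p z.1 z.2‖ₑ ^ (3 / 2 : ℝ) < ∞ →
      ∀ z : ℝ × (EuclideanSpace ℝ (Fin 3)), z.1 ∈ Ioc (T - ρ ^ 2) T → z.2 ∈ ball x₀ ρ →
        ∀ R : ℝ, 0 < R → (∀ r ∈ Ioo 0 R, cknAEss r z u ≤ ENNReal.ofReal ε) →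
        ∃ r₁ : ℝ, 0 < r₁ ∧
          eLpNorm (uncurry u) ∞ (volume.restrict (parabolicCylinder r₁ z)) < ∞ :=
  lemma33_of_estimates localEnergyEstimate_holds pressureEstimate_holds interpolationEstimate_holds
    lemarieRieusset_epsilon_regularity_holds

/-- **Lemma 3.3 with the supremum-in-time scaled energy `A = Fluid.cknA`** and the printed strict
inequality `sup_{0<r<R} A(v, r) < ε`: since `cknAEss ≤ cknA` (`cknAEss_le_cknA`), the
hypothesis of `lemma33` holds.
[cite: SereginSverak2002, Lemma 3.3 (restated verbatim BarkerWang2023 §3 Lemma 1)] -/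
theorem lemma33_cknA :
    ∃ ε : ℝ, 0 < ε ∧
    ∀ (ρ T : ℝ) (x₀ : EuclideanSpace ℝ (Fin 3))
      (u : ℝ → EuclideanSpace ℝ (Fin 3) → EuclideanSpace ℝ (Fin 3))
      (p : ℝ → EuclideanSpace ℝ (Fin 3) → ℝ)
      (G : ℝ → EuclideanSpace ℝ (Fin 3) → EuclideanSpace ℝ (Fin 3) →L[ℝ] EuclideanSpace ℝ (Fin 3)),
      0 < ρ →
      IsSuitableWeakSolutionOn (parabolicCylinderOpens ρ (T, x₀)) 1 0 u p →
      (∃ C : ℝ≥0, ∀ᵐ t : ℝ, t ∈ Ioo (T - ρ ^ 2) T → ∫⁻ x in ball x₀ ρ, ‖u t x‖ₑ ^ 2 ≤ C) →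
      HasWeakSpatialGradientOn (parabolicCylinderOpens ρ (T, x₀)) u G →
      ∫⁻ z in parabolicCylinder ρ (T, x₀), ENNReal.ofReal (frobeniusNormSq (G z.1 z.2)) < ∞ →
      ∫⁻ z in parabolicCylinder ρ (T, x₀), ‖p z.1 z.2‖ₑ ^ (3 / 2 : ℝ) < ∞ →
      ∀ z : ℝ × (EuclideanSpace ℝ (Fin 3)), z.1 ∈ Ioc (T - ρ ^ 2) T → z.2 ∈ ball x₀ ρ →
        ∀ R : ℝ, 0 < R → (∀ r ∈ Ioo 0 R, cknA r z u < ENNReal.ofReal ε) →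
        ∃ r₁ : ℝ, 0 < r₁ ∧
          eLpNorm (uncurry u) ∞ (volume.restrict (parabolicCylinder r₁ z)) < ∞ := by
  obtain ⟨ε, hε, h⟩ := lemma33
  refine ⟨ε, hε, fun ρ T x₀ u p G hρ hsws hCE hG hGint hp z hzt hzx R hR hA => ?_⟩
  exact h ρ T x₀ u p G hρ hsws hCE hG hGint hp z hzt hzx R hR
    fun r hr => (cknAEss_le_cknA.trans (hA r hr).le)

/-- **Lemma 3.3 in the printed setting** (Barker–Wang 2023, §3 Lemma 1, verbatim from
Seregin–Šverák 2002): a suitable weak solution `(v, π)` in the unit backward cylinder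
`Q(0, 1) = B(0, 1) × (-1, 0)` (with the global classes of the definition:
`v ∈ L^∞_t L²_x ∩ L²_t H¹_x`,
`π ∈ L^{3/2}`) and `R* ∈ (0, 1)` with `sup_{0 < R < R*} A(v, R) < ε*` (`A = Fluid.cknA` at the
vertex `(0, 0)`); then `(0, 0)` is a regular point: `v ∈ L^∞(Q(0, r))` for some `r ∈ (0, 1)`.
[cite: SereginSverak2002, Lemma 3.3 (restated verbatim BarkerWang2023 §3 Lemma 1)] -/
theorem lemma33_unitCylinder :
    ∃ ε : ℝ, 0 < ε ∧
    ∀ (v : ℝ → EuclideanSpace ℝ (Fin 3) → EuclideanSpace ℝ (Fin 3))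
      (π : ℝ → EuclideanSpace ℝ (Fin 3) → ℝ)
      (G : ℝ → EuclideanSpace ℝ (Fin 3) → EuclideanSpace ℝ (Fin 3) →L[ℝ] EuclideanSpace ℝ (Fin 3)),
      IsSuitableWeakSolutionOn
        (parabolicCylinderOpens 1 ((0 : ℝ), (0 : EuclideanSpace ℝ (Fin 3)))) 1 0 v π →
      (∃ C : ℝ≥0, ∀ᵐ t : ℝ, t ∈ Ioo (-1 : ℝ) 0 →
        ∫⁻ x in ball (0 : EuclideanSpace ℝ (Fin 3)) 1, ‖v t x‖ₑ ^ 2 ≤ C) →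
      HasWeakSpatialGradientOn
        (parabolicCylinderOpens 1 ((0 : ℝ), (0 : EuclideanSpace ℝ (Fin 3)))) v G →
      ∫⁻ z in parabolicCylinder 1 ((0 : ℝ), (0 : (EuclideanSpace ℝ (Fin 3)))),
          ENNReal.ofReal (frobeniusNormSq (G z.1 z.2)) < ∞ →
      ∫⁻ z in parabolicCylinder 1 ((0 : ℝ), (0 : (EuclideanSpace ℝ (Fin 3)))),
          ‖π z.1 z.2‖ₑ ^ (3 / 2 : ℝ) < ∞ →
      ∀ Rs : ℝ, Rs ∈ Ioo (0 : ℝ) 1 →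
        (∀ R ∈ Ioo 0 Rs, cknA R ((0 : ℝ), (0 : (EuclideanSpace ℝ (Fin 3)))) v < ENNReal.ofReal ε) →
        ∃ r : ℝ, r ∈ Ioo (0 : ℝ) 1 ∧
          eLpNorm (uncurry v) ∞
            (volume.restrict
              (parabolicCylinder r ((0 : ℝ), (0 : (EuclideanSpace ℝ (Fin 3)))))) < ∞ := by
  obtain ⟨ε, hε, h⟩ := lemma33_cknA
  refine ⟨ε, hε, fun v π G hsws hCE hG hGint hp Rs hRs hA => ?_⟩
  have hCE' : ∃ C : ℝ≥0, ∀ᵐ t : ℝ, t ∈ Ioo ((0 : ℝ) - 1 ^ 2) 0 →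
      ∫⁻ x in ball (0 : (EuclideanSpace ℝ (Fin 3))) 1, ‖v t x‖ₑ ^ 2 ≤ C := by simpa using hCE
  obtain ⟨r₁, hr₁, hbd⟩ := h 1 0 0 v π G one_pos hsws hCE' hG hGint hp
    ((0 : ℝ), (0 : (EuclideanSpace ℝ (Fin 3))))
    (by norm_num) (by simp) Rs hRs.1 hA
  -- shrink the radius below `1`
  refine ⟨min r₁ (1 / 2), ⟨by positivity, lt_of_le_of_lt (min_le_right _ _) (by norm_num)⟩, ?_⟩
  refine lt_of_le_of_lt (eLpNorm_mono_measure _ (Measure.restrict_mono ?_ le_rfl)) hbd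
  rw [parabolicCylinder, parabolicCylinder]
  refine prod_mono (Ioo_subset_Ioo ?_ le_rfl) (ball_subset_ball (min_le_left _ _))
  have h0 : 0 ≤ min r₁ (1 / 2) := by positivity
  have : min r₁ (1 / 2) ^ 2 ≤ r₁ ^ 2 := pow_le_pow_left₀ h0 (min_le_left _ _) 2
  simp only
  linarith

/-! ## The criterion at the final time of a classical Leray–Hopf solution -/

/-- **The `A`-criterion at the final time, for the class of the named fact** (`ν = 1`). There is
a universal `ε > 0` such that: if `(u, p)` is a classical solution of the unforced Navier–Stokes
system on `ℝ³ × [0, T)` which is Leray–Hopf on `[0, T)`, `x₀ ∈ ℝ³`, and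
`A(r; (T, x₀)) = ess sup_{T-r²<s<T} r⁻¹ ∫_{B_r(x₀)} |u(s)|² ≤ ε` for all `0 < r < R` (some `R > 0`),
then `u` is bounded on some backward cylinder `(T - r², T) × B(x₀, r)` (`IsBackwardBoundedAt`).
Proof: on `Q_ρ(T, x₀)`, `ρ² < T`, the gauged pair `(u, p − c)` (`c(t) = p(t, 0) − p̃[u(t)](0)`) is
a suitable weak solution in the global classes (`isSuitableWeakSolutionOn_gauge_of_classical`,
the energy bound, the Leray–Hopf weak gradient, `lintegral_slab_gauged_pressure_lt_top`);
`lemma33` gives an essential bound on a top cylinder, which holds everywhere by continuity of `u`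
below `T` (`norm_le_of_ae_restrict_of_continuousOn`).
[cite: SereginSverak2002, Lemma 3.3 (restated verbatim BarkerWang2023 §3 Lemma 1)] -/
theorem isBackwardBoundedAt_of_cknAEss_le :
    ∃ ε : ℝ, 0 < ε ∧
    ∀ (T : ℝ) (u : ℝ → EuclideanSpace ℝ (Fin 3) → EuclideanSpace ℝ (Fin 3))
      (p : ℝ → EuclideanSpace ℝ (Fin 3) → ℝ), 0 < T →
      IsClassicalNSSolutionOn (Ico 0 T) 1 0 u p → IsLerayHopfOn T 1 0 (u 0) u →
      ∀ (x₀ : EuclideanSpace ℝ (Fin 3)) (R : ℝ), 0 < R →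
        (∀ r ∈ Ioo 0 R, cknAEss r (T, x₀) u ≤ ENNReal.ofReal ε) →
        IsBackwardBoundedAt u T x₀ := by
  obtain ⟨ε, hε, h33⟩ := lemma33
  refine ⟨ε, hε, fun T u p hT hsol hLH x₀ R hR hA => ?_⟩
  -- a cylinder `Q_ρ(T, x₀)` inside the open slab `(0, T) × ℝ³`
  obtain ⟨ρ, hρ, hρT⟩ : ∃ ρ : ℝ, 0 < ρ ∧ ρ ^ 2 < T := by
    refine ⟨min 1 (T / 2), by positivity, ?_⟩
    have h1 : min 1 (T / 2) ≤ 1 := min_le_left _ _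
    have h2 : min 1 (T / 2) ≤ T / 2 := min_le_right _ _
    have h0 : 0 ≤ min 1 (T / 2) := by positivity
    nlinarith
  set Q : Opens (ℝ × (EuclideanSpace ℝ (Fin 3))) := parabolicCylinderOpens ρ (T, x₀) with hQdef
  have hQ : (Q : Set (ℝ × (EuclideanSpace ℝ (Fin 3)))) = parabolicCylinder ρ (T, x₀) := rfl
  have hQslab : (Q : Set (ℝ × (EuclideanSpace ℝ (Fin 3)))) ⊆
      Ioo 0 T ×ˢ (univ : Set (EuclideanSpace ℝ (Fin 3))) := by
    rw [hQ, parabolicCylinder]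
    rintro ⟨t, x⟩ ⟨⟨ht1, ht2⟩, -⟩
    exact ⟨⟨by simp only at ht1; linarith, ht2⟩, mem_univ _⟩
  -- the gauged suitable weak solution on `Q`
  set q : ℝ → (EuclideanSpace ℝ (Fin 3)) → ℝ :=
    fun t x => p t x - (p t 0 - normalisedPressure (u t) 0) with hq
  have hsws : IsSuitableWeakSolutionOn Q 1 0 u q :=
    isSuitableWeakSolutionOn_gauge_of_classical one_pos hT hsol hLH Q hQslab
  -- the energy class on `Q`
  have hCE : ∃ C : ℝ≥0, ∀ᵐ t : ℝ, t ∈ Ioo (T - ρ ^ 2) T →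
      ∫⁻ x in ball x₀ ρ, ‖u t x‖ₑ ^ 2 ≤ C := by
    refine ⟨(2 * VectorCalculus.kineticEnergy (u 0)).toNNReal, Eventually.of_forall fun t ht => ?_⟩
    have htc : t ∈ Icc 0 T := ⟨by linarith [ht.1], ht.2.le⟩
    calc ∫⁻ x in ball x₀ ρ, ‖u t x‖ₑ ^ 2 ≤ ∫⁻ x, ‖u t x‖ₑ ^ 2 := setLIntegral_le_lintegral _ _
      _ ≤ ENNReal.ofReal (2 * VectorCalculus.kineticEnergy (u 0)) := eEnergy_le zero_le_one hLH htc
      _ = ((2 * VectorCalculus.kineticEnergy (u 0)).toNNReal : ℝ≥0∞) := rfl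
  -- the Leray–Hopf weak gradient, of finite dissipation on `Q`
  obtain ⟨G, hGslab, -, hGint, -⟩ := hLH.exists_hasWeakSpatialGradientOn
  have hle : Q ≤ slab (EuclideanSpace ℝ (Fin 3)) (Ioo 0 T) isOpen_Ioo := by
    intro z hz
    change z ∈ Ioo 0 T ×ˢ (univ : Set (EuclideanSpace ℝ (Fin 3)))
    exact hQslab hz
  have hG : HasWeakSpatialGradientOn Q u G := hGslab.mono hle
  have hGQ : ∫⁻ z in parabolicCylinder ρ (T, x₀),
      ENNReal.ofReal (frobeniusNormSq (G z.1 z.2)) < ∞ :=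
    lt_of_le_of_lt (lintegral_mono_set (by rw [← hQ]; exact hQslab)) hGint
  -- the gauged pressure in `L^{3/2}(Q)`
  have hqQ : ∫⁻ z in parabolicCylinder ρ (T, x₀), ‖q z.1 z.2‖ₑ ^ (3 / 2 : ℝ) < ∞ :=
    lt_of_le_of_lt (lintegral_mono_set (by rw [← hQ]; exact hQslab))
      (lintegral_slab_gauged_pressure_lt_top one_pos hT hsol hLH)
  -- Lemma 3.3 at the vertex `(T, x₀)`
  obtain ⟨r₁, hr₁, hbd⟩ := h33 ρ T x₀ u q G hρ hsws hCE hG hGQ hqQ (T, x₀)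
    ⟨by simp only; nlinarith, le_rfl⟩ (mem_ball_self hρ) R hR hA
  -- the essential bound on `Q_{r₂}(T, x₀)`, `r₂ = min r₁ ρ`, is an everywhere bound
  set r₂ : ℝ := min r₁ ρ with hr₂
  have hr₂0 : 0 < r₂ := lt_min hr₁ hρ
  have hsub : parabolicCylinder r₂ (T, x₀) ⊆ parabolicCylinder r₁ (T, x₀) := by
    rw [parabolicCylinder, parabolicCylinder]
    refine prod_mono (Ioo_subset_Ioo ?_ le_rfl) (ball_subset_ball (min_le_left _ _))
    have : r₂ ^ 2 ≤ r₁ ^ 2 := pow_le_pow_left₀ hr₂0.le (min_le_left _ _) 2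
    simp only
    linarith
  have hsubIco : parabolicCylinder r₂ (T, x₀) ⊆
      Ico 0 T ×ˢ (univ : Set (EuclideanSpace ℝ (Fin 3))) := by
    rw [parabolicCylinder]
    rintro ⟨t, x⟩ ⟨⟨ht1, ht2⟩, -⟩
    have : r₂ ^ 2 ≤ ρ ^ 2 := pow_le_pow_left₀ hr₂0.le (min_le_right _ _) 2
    exact ⟨⟨by simp only at ht1; nlinarith, ht2⟩, mem_univ _⟩
  set M : ℝ≥0∞ := eLpNormEssSup (uncurry u) (volume.restrict (parabolicCylinder r₁ (T, x₀)))
    with hM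
  have hMtop : M < ∞ := by rw [hM, ← eLpNorm_exponent_top]; exact hbd
  have hae : ∀ᵐ z ∂(volume.restrict (parabolicCylinder r₁ (T, x₀))),
      ‖uncurry u z‖ ≤ M.toReal := by
    filter_upwards [ae_le_eLpNormEssSup (f := uncurry u)
      (μ := volume.restrict (parabolicCylinder r₁ (T, x₀)))] with z hz
    have := ENNReal.toReal_mono hMtop.ne hz
    rwa [toReal_enorm] at this
  have hcont : ContinuousOn (uncurry u) (parabolicCylinder r₂ (T, x₀)) :=
    (continuousOn_uncurry hsol).mono hsubIco
  have hall := norm_le_of_ae_restrict_of_continuousOn (isOpen_parabolicCylinder r₂ (T, x₀)) hcont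
    (ae_restrict_of_ae_restrict_of_subset hsub hae)
  refine ⟨r₂, hr₂0, M.toReal, fun t ht x hx => ?_⟩
  exact hall (t, x) (mk_mem_prod ht hx)

end SereginSverak2002

end Literature.Analysis.FluidPDE

end
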